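import Summits.QuantumFields.BalabanUV.Beta.FP.RepAlgebraTrace

/-!
# `BalabanUV.Beta.FP.RepAlgebraTsum` — binder row D1, the row's ONE file, (X)'s bookkeeping tool (J-NOTE-21 §4 (ii) ∕ §5): **THE TADPOLE IS LINEAR ACROSS AN ARBITRARILY INDEXED `ℓ¹`
# SUPERPOSITION OF UNIFORMLY BI-LOCALISED STENCILS** — `tadpole A (Σ'_i c i • T i) = Σ'_i c i · tadpole A (T i)` for a decaying `A`, stencils `T i` bi-localised at their own centres `(p i, p i)`
# with a common constant and rate, and `Σ_i |c i| < ∞`; the index type is ARBITRARY (the door's windows `β : Site × Fin 4`, J-NOTE-21 §5), unlike the site-indexed `wsum` of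
# `RepAlgebraBubble.tadpole_wsum` whose index IS the centre
# (β-function cell `pub-balaban`, BINDER-OWNERS row D1 ∕ (C1) OWNER «beta-an2» gen 77, PART 63; imports the row's `RepAlgebraTrace`)

WHAT ([folklore] `tsum` Fubini bookkeeping BY NAME, the patterns of `RepAlgebraTrace.tr_wsum` ∕ `RepAlgebraBubble.tadpole_wsum` with an abstract index; no `def`, no `def … : Prop`, nothing cited, 0 sorry).
§1 abstract domination: `comp_tsumKer_right` (`comp A (x z a b ↦ Σ'_i c i·T i x z a b) = x z a b ↦ Σ'_i c i·comp A (T i) x z a b` given entrywise summability and a summable double family on `Site × ι`),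
`tr_tsumKer` (`tr (Σ'_i c i·K i) = Σ'_i c i·tr (K i)`, same shape as `tr_wsum`).
§2 **`tadpole_tsumKer`**: `Decays A C δ`, `0 < δ`, `∀ i, BiLoc (T i) (p i) (p i) CT δ`, `Summable |c|` ⟹ `tadpole A (x z a b ↦ Σ'_i c i·T i x z a b) = Σ'_i c i·tadpole A (T i)` (dominations: `|c i|·|F|·C·CT·e^{−δ|x−y|₁}` for
the composition, `|c i|·|F|·c₀·e^{−(δ/2)|x − p i|₁}` for the trace, `c₀` from lit `biLoc_comp_decays`; `summable_mul_of_summable_norm`, `summable_prod_of_nonneg` in the `(i, x)` order, `Equiv.prodComm`);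
`summable_mul_tadpole` (the right side converges absolutely: `|tadpole A (T i)|` is bounded uniformly in `i` by lit `abs_tadpole_le`).
WHAT THIS IS NOT: not the door's `hX` itself (its stencils' bi-localisation comes from the tables' letters — next files); nothing of Bałaban's asserted, valued or discharged; 0 estimates (generic bookkeeping
constants); 0∕4 row-D1 binders (hW, hR, D1Tel, D1Rep); NOT (C1), NOT D1, NEVER «G-an2-4 closed», NOT BetaPertH, NOT continuum, NOT Clay.

HONEST DEPENDENCY (page 1, mandatory): continuum YM on T⁴ ⇐ BetaPertH ∧ nine spine estimates (0/9 proved); BetaPertH ⇐ (D1) ∧ (D4) ∧ CAP+tail;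
G-an2-4 gates asym, D1 and NE2/3/4.  HONEST FRAMING (cell contract, verbatim): «discharging `BetaPertH` makes Bałaban's UV stability UNCONDITIONAL —
a real constructive-QFT result; it is NOT the continuum limit and NOT the Clay problem.»  ABSOLUTE RULE (cell charter, verbatim): «No internally-minted
statement may enter as a cited fact. Every hypothesis is either kernel-proved in this package or a verbatim quotation of a PUBLISHED theorem with page
reference. The manuscript(s) under audit are NOT citable for their own disputed steps — they are the thing under adjudication; programme-internal
(2001/route/tribunal) claims are never citable.»  Row D1 ∕ (C1) OWNER «beta-an2» gen 77, 2026-08-29.  No existing file touched.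
-/

noncomputable section

open Finset Filter Topology
open scoped BigOperators
open Literature.MathematicalPhysics.QuantumFieldTheory.Balaban1983to89
open Literature.MathematicalPhysics.QuantumFieldTheory.Balaban1983to89.B12Sec2to5 (l1 l1_nonneg summable_exp_neg_l1)
open Literature.MathematicalPhysics.QuantumFieldTheory.Balaban1983to89.Beta.ExpKernelCalculus
open Summit.QuantumFields.BalabanUV.Beta.FP.RepAlgebraTrace (abs_le_of_biLoc)

namespace Summit.QuantumFields.BalabanUV.Beta.FP.RepAlgebraTsum

variable {D : ℕ} {F : Type*} [Fintype F] {ι : Type*}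

/-! ## §1 Abstract domination: `comp` and `tr` through an indexed superposition -/

/-- [folklore] **`comp` through an indexed superposition on the right**: if every entry series `i ↦ c i·T i y z f b` is summable and, for the given `(x, z, a, b)`, the double family
`(y, i) ↦ c i·Σ_f A x y a f·T i y z f b` is summable, then `comp A (Σ'_i c i·T i) x z a b = Σ'_i c i·comp A (T i) x z a b`. -/
theorem comp_tsumKer_right_apply (A : MKer D F) (c : ι → ℝ) (T : ι → MKer D F) (x z : Site D) (a b : F)
    (hent : ∀ (y : Site D) (f : F), Summable fun i => c i * T i y z f b)
    (hdom : Summable fun yi : Site D × ι => c yi.2 * ∑ f, A x yi.1 a f * T yi.2 yi.1 z f b) :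
    comp A (fun y z f b => ∑' i, c i * T i y z f b) x z a b = ∑' i, c i * comp A (T i) x z a b := by
  set G : Site D → ι → ℝ := fun y i => c i * ∑ f, A x y a f * T i y z f b with hG
  have hsum : Summable (Function.uncurry G) := hdom
  have hy : ∀ y, Summable (G y) := fun y => hsum.prod_factor y
  have hi : ∀ i, Summable fun y => G y i := fun i => hsum.prod_symm.prod_factor i
  have eL : comp A (fun y z f b => ∑' i, c i * T i y z f b) x z a b = ∑' y, ∑' i, G y i := by
    show (∑' y, ∑ f, A x y a f * ∑' i, c i * T i y z f b) = ∑' y, ∑' i, G y i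
    refine tsum_congr fun y => ?_
    have e1 : ∀ f, A x y a f * (∑' i, c i * T i y z f b) = ∑' i, A x y a f * (c i * T i y z f b) := fun f => by
      rw [← tsum_mul_left]
    simp_rw [e1]
    rw [← Summable.tsum_finsetSum fun f _ => (hent y f).mul_left (A x y a f)]
    refine tsum_congr fun i => ?_
    simp only [hG, Finset.mul_sum]
    refine Finset.sum_congr rfl fun f _ => ?_
    ring
  have eR : (∑' i, c i * comp A (T i) x z a b) = ∑' i, ∑' y, G y i := by
    refine tsum_congr fun i => ?_
    show c i * (∑' y, ∑ f, A x y a f * T i y z f b) = ∑' y, G y i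
    rw [← tsum_mul_left]
  rw [eL, eR]
  exact (hsum.tsum_comm' hy hi).symm

/-- [folklore] **`tr` through an indexed superposition** (abstract domination; the shape of `RepAlgebraTrace.tr_wsum` with an arbitrary index): if every diagonal entry series
`i ↦ c i·K i x x a a` is summable and the double family `(x, i) ↦ c i·Σ_a K i x x a a` is summable, then `tr (Σ'_i c i·K i) = Σ'_i c i·tr (K i)`. -/
theorem tr_tsumKer (c : ι → ℝ) (K : ι → MKer D F)
    (hent : ∀ (x : Site D) (a : F), Summable fun i => c i * K i x x a a)
    (hdom : Summable fun xi : Site D × ι => c xi.2 * ∑ a, K xi.2 xi.1 xi.1 a a) :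
    tr (fun x z a b => ∑' i, c i * K i x z a b) = ∑' i, c i * tr (K i) := by
  set G : Site D → ι → ℝ := fun x i => c i * ∑ a, K i x x a a with hG
  have hsum : Summable (Function.uncurry G) := hdom
  have hx : ∀ x, Summable (G x) := fun x => hsum.prod_factor x
  have hi : ∀ i, Summable fun x => G x i := fun i => hsum.prod_symm.prod_factor i
  have eL : tr (fun x z a b => ∑' i, c i * K i x z a b) = ∑' x, ∑' i, G x i := by
    show (∑' x, ∑ a, ∑' i, c i * K i x x a a) = ∑' x, ∑' i, G x i
    refine tsum_congr fun x => ?_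
    rw [← Summable.tsum_finsetSum fun a _ => hent x a]
    refine tsum_congr fun i => ?_
    show (∑ a, c i * K i x x a a) = c i * ∑ a, K i x x a a
    rw [Finset.mul_sum]
  have eR : (∑' i, c i * tr (K i)) = ∑' i, ∑' x, G x i := by
    refine tsum_congr fun i => ?_
    show c i * (∑' x, ∑ a, K i x x a a) = ∑' x, G x i
    rw [← tsum_mul_left]
  rw [eL, eR]
  exact (hsum.tsum_comm' hx hi).symm

/-! ## §2 The tadpole through an `ℓ¹` superposition of uniformly bi-localised stencils -/

section Tadpole

variable {A : MKer D F} {C δ : ℝ}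

/-- [folklore] **`tadpole_tsumKer` — THE TADPOLE IS LINEAR ACROSS AN `ℓ¹` SUPERPOSITION OF UNIFORMLY BI-LOCALISED STENCILS** (arbitrary index type; centres `p i`): for `Decays A C δ`, `0 < δ`,
`BiLoc (T i) (p i) (p i) CT δ` for every `i`, and `Σ_i |c i| < ∞`: `tadpole A (x z a b ↦ Σ'_i c i·T i x z a b) = Σ'_i c i·tadpole A (T i)`. -/
theorem tadpole_tsumKer (hA : Decays A C δ) (hδ : 0 < δ) {T : ι → MKer D F} {p : ι → Site D} {CT : ℝ} (hCT : 0 ≤ CT)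
    (hT : ∀ i, BiLoc (T i) (p i) (p i) CT δ) {c : ι → ℝ} (hc : Summable fun i => |c i|) :
    tadpole A (fun x z a b => ∑' i, c i * T i x z a b) = ∑' i, c i * tadpole A (T i) := by
  classical
  rcases isEmpty_or_nonempty F with hF | ⟨⟨a₀⟩⟩
  · simp [tadpole, tr, comp]
  have hC : 0 ≤ C := hA.nonneg a₀
  have hδ2 : 0 < δ / 2 := half_pos hδ
  -- Step A: the composition passes through the superposition, pointwise
  have hcompA : comp A (fun y z f b => ∑' i, c i * T i y z f b) = fun x z a b => ∑' i, c i * comp A (T i) x z a b := by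
    funext x z a b
    refine comp_tsumKer_right_apply A c T x z a b (fun y f => ?_) ?_
    · -- entry series: `|c i·T i y z f b| ≤ |c i|·CT`
      refine Summable.of_norm_bounded (hc.mul_right CT) fun i => ?_
      rw [Real.norm_eq_abs, abs_mul]
      exact mul_le_mul_of_nonneg_left (abs_le_of_biLoc (hT i) hδ.le y z f b) (abs_nonneg _)
    · -- double family on `Site × ι`: dominated by `(C·|F|·CT·e^{−δ|x−y|₁}) · |c i|`
      have hmaj : Summable fun yi : Site D × ι =>
          ((Fintype.card F : ℝ) * (C * CT) * Real.exp (-δ * l1 (x - yi.1))) * |c yi.2| := by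
        have h1 : Summable fun y : Site D => ‖(Fintype.card F : ℝ) * (C * CT) * Real.exp (-δ * l1 (x - y))‖ := by
          refine ((summable_exp_shift hδ x).mul_left ((Fintype.card F : ℝ) * (C * CT))).norm
        have h2 : Summable fun i => ‖|c i|‖ := by simpa using hc
        exact summable_mul_of_summable_norm h1 h2
      refine Summable.of_norm_bounded hmaj fun yi => ?_
      rw [Real.norm_eq_abs, abs_mul, mul_comm]
      refine mul_le_mul_of_nonneg_right ?_ (abs_nonneg _)
      refine (Finset.abs_sum_le_sum_abs _ _).trans ?_
      have hterm : ∀ f, |A x yi.1 a f * T yi.2 yi.1 z f b| ≤ C * CT * Real.exp (-δ * l1 (x - yi.1)) := by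
        intro f
        rw [abs_mul]
        calc |A x yi.1 a f| * |T yi.2 yi.1 z f b| ≤ (C * Real.exp (-δ * l1 (x - yi.1))) * CT :=
              mul_le_mul (hA x yi.1 a f) (abs_le_of_biLoc (hT yi.2) hδ.le yi.1 z f b) (abs_nonneg _) (by positivity)
          _ = C * CT * Real.exp (-δ * l1 (x - yi.1)) := by ring
      refine (Finset.sum_le_sum fun f _ => hterm f).trans ?_
      rw [Finset.sum_const, nsmul_eq_mul, Finset.card_univ]
      exact le_of_eq (by ring)
  unfold tadpole
  rw [hcompA]
  -- Step B: the trace passes through the superposition of the compositions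
  set c₀ : ℝ := (Fintype.card F : ℝ) * (C * CT) * Zl D (δ - δ / 2) with hc₀
  have hc₀nn : 0 ≤ c₀ := by rw [hc₀]; have := Zl_nonneg (D := D) (show 0 < δ - δ / 2 by linarith); positivity
  have hK : ∀ i, BiLoc (comp A (T i)) (p i) (p i) c₀ (δ / 2) := fun i => biLoc_comp_decays hA (hT i) hδ2.le (by linarith)
  refine tr_tsumKer c (fun i => comp A (T i)) (fun x a => ?_) ?_
  · -- entry series: `|c i·(A∘T i) x x a a| ≤ |c i|·c₀`
    refine Summable.of_norm_bounded (hc.mul_right c₀) fun i => ?_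
    rw [Real.norm_eq_abs, abs_mul]
    exact mul_le_mul_of_nonneg_left (abs_le_of_biLoc (hK i) hδ2.le x x a a) (abs_nonneg _)
  · -- double family on `Site × ι`: dominated by `g (x, i) := |c i|·|F|·c₀·e^{−(δ/2)|x − p i|₁}`, summed in the `(i, x)` order
    set g : Site D × ι → ℝ := fun xi => |c xi.2| * ((Fintype.card F : ℝ) * c₀ * Real.exp (-(δ / 2) * l1 (xi.1 - p xi.2))) with hg
    have hg0 : ∀ q, 0 ≤ g q := fun q => by rw [hg]; positivity
    have hgs : Summable g := by
      have hsw : Summable (fun q : ι × Site D => g (Equiv.prodComm _ _ q)) := by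
        rw [summable_prod_of_nonneg (fun q => hg0 _)]
        constructor
        · intro i
          simpa [hg] using ((summable_exp_shift' hδ2 (p i)).mul_left ((Fintype.card F : ℝ) * c₀)).mul_left (|c i|)
        · have e : ∀ i, (∑' x : Site D, g (Equiv.prodComm ι (Site D) (i, x))) = |c i| * ((Fintype.card F : ℝ) * c₀ * Zl D (δ / 2)) := by
            intro i
            simp only [hg, Equiv.prodComm_apply, Prod.swap]
            rw [tsum_mul_left, tsum_mul_left, tsum_exp_shift' (c := δ / 2) (p i)]
          simp_rw [e]
          exact hc.mul_right _
      exact (Equiv.prodComm ι (Site D)).summable_iff.mp hsw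
    refine Summable.of_nonneg_of_le (fun q => abs_nonneg _) (fun xi => ?_) hgs |>.of_abs
    rw [abs_mul, hg]
    refine mul_le_mul_of_nonneg_left ?_ (abs_nonneg _)
    refine (Finset.abs_sum_le_sum_abs _ _).trans ?_
    have hterm : ∀ a, |comp A (T xi.2) xi.1 xi.1 a a| ≤ c₀ * Real.exp (-(δ / 2) * l1 (xi.1 - p xi.2)) := by
      intro a
      refine (hK xi.2 xi.1 xi.1 a a).trans ?_
      refine mul_le_mul_of_nonneg_left (Real.exp_le_exp.mpr ?_) hc₀nn
      nlinarith [l1_nonneg (xi.1 - p xi.2), hδ2.le]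
    refine (Finset.sum_le_sum fun a _ => hterm a).trans ?_
    rw [Finset.sum_const, nsmul_eq_mul, Finset.card_univ]
    exact le_of_eq (by ring)

/-- [folklore] the right side of `tadpole_tsumKer` converges absolutely: `i ↦ c i·tadpole A (T i)` is summable (`|tadpole A (T i)|` is bounded uniformly in `i` by lit `abs_tadpole_le`). -/
theorem summable_mul_tadpole (hA : Decays A C δ) (hδ : 0 < δ) {T : ι → MKer D F} {p : ι → Site D} {CT : ℝ}
    (hT : ∀ i, BiLoc (T i) (p i) (p i) CT δ) {c : ι → ℝ} (hc : Summable fun i => |c i|) :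
    Summable fun i => c i * tadpole A (T i) := by
  set B : ℝ := (Fintype.card F : ℝ) * ((Fintype.card F : ℝ) * (C * CT) * Zl D (δ - δ / 2)) * Zl D (δ / 2 / 2) with hBdef
  have hB : ∀ i, |tadpole A (T i)| ≤ B := fun i => by
    have h := abs_tadpole_le hA (hT i) hδ
    rwa [sub_self, show l1 (0 : Site D) = 0 by simp [l1], mul_zero, Real.exp_zero, mul_one] at h
  refine Summable.of_norm_bounded (hc.mul_right B) fun i => ?_
  rw [Real.norm_eq_abs, abs_mul]
  exact mul_le_mul_of_nonneg_left (hB i) (abs_nonneg _)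

end Tadpole

end Summit.QuantumFields.BalabanUV.Beta.FP.RepAlgebraTsum

end
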